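import Summits.Ventures.PercRepro.C041TreeStates
import Summits.Ventures.PercRepro.C041ZoneOCubeCountDefs

/-!
# ROW C-041 — the bridge «tree zone of the graph model ↦ TZ», definitions (mine-3, gen 57; C-041.md §19 (k))

A rooted marked tree `t : TZ` is turned into an abstract zone of the graph model of C041ZoneZDefs: its POSITIONS
(`TZ.Pos`: the root, or a position inside a child), its EDGES (`TZ.Edge`: the edge from the root to child `j`, or an
edge inside child `j`), its 1-marks and 2-marks (`TZ.M1`, `TZ.M2`: the root's own marks or a mark inside a child), and
the zone data `TZ.toZone t : ZoneData t.Pos t.Edge t.M1 t.M2` (every edge joins a position to its parent, every mark sits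
at its position). A state of that zone — a colouring of its edges and marks — is the same thing as a state of the tree
in the sense of C041TreeStates: **`TZ.stateEquiv t : State t.Edge t.M1 t.M2 ≃ t.St`**, by recursion. The four
correspondences `none ∈ D σ ↔ rb1`, `none ∈ D2 σ ↔ rb2`, `adm ↔ adm`, `blueK {none} ↔ ¬ redK` and the count
identities `#Fset none = cF` … (§19 (k)) are the next module; with them THEOREM (trees) holds on every `t.toZone` in
the tree's own vocabulary.
-/

namespace PercRepro

namespace TreeClosure

open ZoneZ

/-- The positions of a tree: the root (`none`) or a position inside the child `j`. -/
def TZ.Pos : TZ → Type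
  | .node _ _ d cs => Option (Σ j : Fin d, TZ.Pos (cs j))

/-- The root position. -/
def TZ.root : (t : TZ) → t.Pos
  | .node _ _ _ _ => none

/-- The edges of a tree: `⟨j, none⟩` is the edge from the root to child `j`, `⟨j, some e⟩` the edge `e` inside child `j`. -/
def TZ.Edge : TZ → Type
  | .node _ _ d cs => Σ j : Fin d, Option (TZ.Edge (cs j))

/-- The 1-marks of a tree: the root's own (`inl i`) or a 1-mark inside child `j`. -/
def TZ.M1 : TZ → Type
  | .node p _ d cs => Fin p ⊕ Σ j : Fin d, TZ.M1 (cs j)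

/-- The 2-marks of a tree. -/
def TZ.M2 : TZ → Type
  | .node _ q d cs => Fin q ⊕ Σ j : Fin d, TZ.M2 (cs j)

/-- The positions are finite. -/
@[reducible] def TZ.posFintype : (t : TZ) → Fintype t.Pos
  | .node _ _ d cs =>
    haveI : ∀ j, Fintype (cs j).Pos := fun j => TZ.posFintype (cs j)
    inferInstanceAs (Fintype (Option (Σ j : Fin d, TZ.Pos (cs j))))

/-- Positions have decidable equality. -/
@[reducible] def TZ.posDecEq : (t : TZ) → DecidableEq t.Pos
  | .node _ _ d cs =>
    haveI : ∀ j, DecidableEq (cs j).Pos := fun j => TZ.posDecEq (cs j)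
    inferInstanceAs (DecidableEq (Option (Σ j : Fin d, TZ.Pos (cs j))))

/-- The edges are finite. -/
@[reducible] def TZ.edgeFintype : (t : TZ) → Fintype t.Edge
  | .node _ _ d cs =>
    haveI : ∀ j, Fintype (cs j).Edge := fun j => TZ.edgeFintype (cs j)
    inferInstanceAs (Fintype (Σ j : Fin d, Option (TZ.Edge (cs j))))

/-- Edges have decidable equality. -/
@[reducible] def TZ.edgeDecEq : (t : TZ) → DecidableEq t.Edge
  | .node _ _ d cs =>
    haveI : ∀ j, DecidableEq (cs j).Edge := fun j => TZ.edgeDecEq (cs j)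
    inferInstanceAs (DecidableEq (Σ j : Fin d, Option (TZ.Edge (cs j))))

/-- The 1-marks are finite. -/
@[reducible] def TZ.m1Fintype : (t : TZ) → Fintype t.M1
  | .node p _ d cs =>
    haveI : ∀ j, Fintype (cs j).M1 := fun j => TZ.m1Fintype (cs j)
    inferInstanceAs (Fintype (Fin p ⊕ Σ j : Fin d, TZ.M1 (cs j)))

/-- 1-marks have decidable equality. -/
@[reducible] def TZ.m1DecEq : (t : TZ) → DecidableEq t.M1
  | .node p _ d cs =>
    haveI : ∀ j, DecidableEq (cs j).M1 := fun j => TZ.m1DecEq (cs j)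
    inferInstanceAs (DecidableEq (Fin p ⊕ Σ j : Fin d, TZ.M1 (cs j)))

/-- The 2-marks are finite. -/
@[reducible] def TZ.m2Fintype : (t : TZ) → Fintype t.M2
  | .node _ q d cs =>
    haveI : ∀ j, Fintype (cs j).M2 := fun j => TZ.m2Fintype (cs j)
    inferInstanceAs (Fintype (Fin q ⊕ Σ j : Fin d, TZ.M2 (cs j)))

/-- 2-marks have decidable equality. -/
@[reducible] def TZ.m2DecEq : (t : TZ) → DecidableEq t.M2
  | .node _ q d cs =>
    haveI : ∀ j, DecidableEq (cs j).M2 := fun j => TZ.m2DecEq (cs j)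
    inferInstanceAs (DecidableEq (Fin q ⊕ Σ j : Fin d, TZ.M2 (cs j)))

/-- Finiteness of the positions. -/
instance (t : TZ) : Fintype t.Pos := TZ.posFintype t
/-- Decidable equality of the positions. -/
instance (t : TZ) : DecidableEq t.Pos := TZ.posDecEq t
/-- Finiteness of the edges. -/
instance (t : TZ) : Fintype t.Edge := TZ.edgeFintype t
/-- Decidable equality of the edges. -/
instance (t : TZ) : DecidableEq t.Edge := TZ.edgeDecEq t
/-- Finiteness of the 1-marks. -/
instance (t : TZ) : Fintype t.M1 := TZ.m1Fintype t
/-- Decidable equality of the 1-marks. -/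
instance (t : TZ) : DecidableEq t.M1 := TZ.m1DecEq t
/-- Finiteness of the 2-marks. -/
instance (t : TZ) : Fintype t.M2 := TZ.m2Fintype t
/-- Decidable equality of the 2-marks. -/
instance (t : TZ) : DecidableEq t.M2 := TZ.m2DecEq t

/-- The zone of a tree: every edge joins a position to its parent (the root edge of child `j` joins the root to the
child's root), every mark sits at its position. -/
def TZ.toZone : (t : TZ) → ZoneData t.Pos t.Edge t.M1 t.M2
  | .node _ _ _ cs =>
    { fst := fun e => match e with
        | ⟨_, none⟩ => none
        | ⟨j, some e'⟩ => some ⟨j, (TZ.toZone (cs j)).fst e'⟩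
      snd := fun e => match e with
        | ⟨j, none⟩ => some ⟨j, TZ.root (cs j)⟩
        | ⟨j, some e'⟩ => some ⟨j, (TZ.toZone (cs j)).snd e'⟩
      at₁ := fun m => match m with
        | Sum.inl _ => none
        | Sum.inr ⟨j, m'⟩ => some ⟨j, (TZ.toZone (cs j)).at₁ m'⟩
      at₂ := fun m => match m with
        | Sum.inl _ => none
        | Sum.inr ⟨j, m'⟩ => some ⟨j, (TZ.toZone (cs j)).at₂ m'⟩ }

/-- **THE STATE EQUIVALENCE**: a colouring of the edges and marks of `t.toZone` is a state of the tree in the sense of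
C041TreeStates — the root's marks, and for every child the colour of its root edge with a state of the child. -/
def TZ.stateEquiv : (t : TZ) → State t.Edge t.M1 t.M2 ≃ t.St
  | .node p q d cs =>
    { toFun := fun σ =>
        (fun i => σ.2.1 (Sum.inl i), fun i => σ.2.2 (Sum.inl i),
          fun j => (σ.1 ⟨j, none⟩, TZ.stateEquiv (cs j)
            (fun e => σ.1 ⟨j, some e⟩, fun m => σ.2.1 (Sum.inr ⟨j, m⟩), fun m => σ.2.2 (Sum.inr ⟨j, m⟩))))
      invFun := fun s =>
        (fun e => match e with
          | ⟨j, none⟩ => (s.2.2 j).1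
          | ⟨j, some e'⟩ => ((TZ.stateEquiv (cs j)).symm (s.2.2 j).2).1 e',
         fun m => match m with
          | Sum.inl i => s.1 i
          | Sum.inr ⟨j, m'⟩ => ((TZ.stateEquiv (cs j)).symm (s.2.2 j).2).2.1 m',
         fun m => match m with
          | Sum.inl i => s.2.1 i
          | Sum.inr ⟨j, m'⟩ => ((TZ.stateEquiv (cs j)).symm (s.2.2 j).2).2.2 m')
      left_inv := by
        rintro ⟨c, m1, m2⟩
        refine Prod.ext ?_ (Prod.ext ?_ ?_)
        · funext e
          rcases e with ⟨j, _ | e'⟩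
          · rfl
          · simp only []
            have h := (TZ.stateEquiv (cs j)).symm_apply_apply
              (fun e => c ⟨j, some e⟩, fun m => m1 (Sum.inr ⟨j, m⟩), fun m => m2 (Sum.inr ⟨j, m⟩))
            exact congrFun (congrArg Prod.fst h) e'
        · funext m
          rcases m with i | ⟨j, m'⟩
          · rfl
          · simp only []
            have h := (TZ.stateEquiv (cs j)).symm_apply_apply
              (fun e => c ⟨j, some e⟩, fun m => m1 (Sum.inr ⟨j, m⟩), fun m => m2 (Sum.inr ⟨j, m⟩))
            exact congrFun (congrArg (fun x => x.2.1) h) m'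
        · funext m
          rcases m with i | ⟨j, m'⟩
          · rfl
          · simp only []
            have h := (TZ.stateEquiv (cs j)).symm_apply_apply
              (fun e => c ⟨j, some e⟩, fun m => m1 (Sum.inr ⟨j, m⟩), fun m => m2 (Sum.inr ⟨j, m⟩))
            exact congrFun (congrArg (fun x => x.2.2) h) m'
      right_inv := by
        rintro ⟨r1, r2, ch⟩
        refine Prod.ext rfl (Prod.ext rfl ?_)
        funext j
        refine Prod.ext rfl ?_
        simp only []
        exact (TZ.stateEquiv (cs j)).apply_symm_apply (ch j).2 }

end TreeClosure

end PercRepro
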